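import Summits.Ventures.PercRepro.Night2NearFatLines

/-!
# night-2: THE LONG LINES OF A BASIS PAIR (gen 40)

For a basis pair with `W = G ∖ Q` and a start level `s`, the basis lines with `≥ s − 1` points of `W` are pairwise disjoint
on `W` (Night2NearFatLines' `clF_pair_eq_of_mem_of_mem`) and the lines through a basis point with `≥ s` points of `W`
pairwise share at most one point (`clF_eq_of_two_mem_inter`); with `|W| < 3 (s − 1)` and `|W| + 3 < 3 s` the packing
lemmas give two covering sets of each kind: **`ntp_structure`** returns `ℓ₁, ℓ₂, C₁, C₂` with the covering hypotheses of
`basis_pair_fair_of_ntp`, their sizes and origins, and the pairwise intersection facts the cell arithmetic needs.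
Paper: proofs/NIGHT-2-g40.md §4.
-/

namespace PercRepro.Shadow

open PercRepro.ThmH PercRepro.PerFlat

variable {α : Type*} [DecidableEq α] {M : Matroid α} [M.Finite] {G : Finset α}

/-- A basis line with a point `y` of `W` is the line through `a` and `y`. -/
theorem inter_clF_pair_eq_of_mem (hs : ∀ e ∈ gr M, ∀ f ∈ gr M, e ≠ f → rkN M {e, f} = 2) {W : Finset α}
    (hWg : W ⊆ gr M) {a b y : α} (ha : a ∈ gr M) (hb : b ∈ gr M) (hab : a ≠ b) (hy : y ∈ W ∩ clF M {a, b})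
    (hay : a ≠ y) : W ∩ clF M {a, b} = W ∩ clF M {a, y} := by
  rw [Finset.mem_inter] at hy
  have hpair : ({a, b} : Finset α) ⊆ gr M := by
    intro e he
    rw [Finset.mem_insert, Finset.mem_singleton] at he
    rcases he with rfl | rfl
    · exact ha
    · exact hb
  have h := clF_pair_eq_of_subset_clF_pair hs ha hb ha (hWg hy.1) hab hay
    (subset_clF_of_subset_gr hpair (Finset.mem_insert_self _ _)) hy.2
  rw [h]

/-- **The long lines of a basis pair**: the covering sets of `basis_pair_fair_of_ntp` with their sizes, origins and
pairwise intersections. -/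
theorem ntp_structure (hG : G ∈ flatsQ M (5 + 1)) (hd : (gr M \ G).card = 2) (hk : kColoops M G = 1)
    (hs : ∀ e ∈ gr M, ∀ f ∈ gr M, e ≠ f → rkN M {e, f} = 2) (hl : ∀ e ∈ gr M, M.Indep {e})
    {B : Finset α} (hB : B ∈ thinMembers M 5 G) (hnP : ¬ bigP M G B) {z : α} (hz : z ∈ G \ clF M B)
    {s : ℕ} (hs2 : 2 ≤ s) (hmB : (G \ insert z B).card < 3 * (s - 1)) (hmC : (G \ insert z B).card + 3 < 3 * s) :
    ∃ ℓ₁ ℓ₂ C₁ C₂ : Finset α, ℓ₁ ⊆ G \ insert z B ∧ ℓ₂ ⊆ G \ insert z B ∧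
      (∀ a ∈ insert z B \ coloops M G, ∀ b ∈ insert z B \ coloops M G, a ≠ b →
        (G \ insert z B) ∩ clF M {a, b} ⊆ ℓ₁ ∨ (G \ insert z B) ∩ clF M {a, b} ⊆ ℓ₂ ∨
          ((G \ insert z B) ∩ clF M {a, b}).card + 2 ≤ s) ∧
      (∀ a ∈ insert z B \ coloops M G, ∀ y ∈ G \ insert z B,
        (G \ insert z B) ∩ clF M {a, y} ⊆ C₁ ∨ (G \ insert z B) ∩ clF M {a, y} ⊆ C₂ ∨
          ((G \ insert z B) ∩ clF M {a, y}).card + 1 ≤ s) ∧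
      (ℓ₁ = ∅ ∨ (s - 1 ≤ ℓ₁.card ∧ ∃ a ∈ insert z B \ coloops M G, ∃ b ∈ insert z B \ coloops M G, a ≠ b ∧
        ℓ₁ = (G \ insert z B) ∩ clF M {a, b})) ∧
      (ℓ₂ = ∅ ∨ (s - 1 ≤ ℓ₂.card ∧ ∃ a ∈ insert z B \ coloops M G, ∃ b ∈ insert z B \ coloops M G, a ≠ b ∧
        ℓ₂ = (G \ insert z B) ∩ clF M {a, b})) ∧
      (ℓ₁ = ℓ₂ ∨ (ℓ₁ ∩ ℓ₂).card = 0) ∧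
      (C₁ = ∅ ∨ (s ≤ C₁.card ∧ ∃ a ∈ insert z B \ coloops M G, ∃ y ∈ G \ insert z B,
        C₁ = (G \ insert z B) ∩ clF M {a, y})) ∧
      (C₂ = ∅ ∨ (s ≤ C₂.card ∧ ∃ a ∈ insert z B \ coloops M G, ∃ y ∈ G \ insert z B,
        C₂ = (G \ insert z B) ∩ clF M {a, y})) ∧
      (C₁ = C₂ ∨ (C₁ ∩ C₂).card ≤ 1) ∧
      (∀ ℓ C : Finset α, (ℓ = ℓ₁ ∨ ℓ = ℓ₂) → (C = C₁ ∨ C = C₂) → ℓ = C ∨ (ℓ ∩ C).card ≤ 1) := by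
  set W := G \ insert z B with hW
  set Q' := insert z B \ coloops M G with hQ'
  have hGg : G ⊆ gr M := (mem_flatsQ.1 hG).1
  have hQG : insert z B ⊆ G := Finset.insert_subset (Finset.mem_sdiff.1 hz).1 (subset_G_of_mem_thinMembers hB)
  have hQ'g : Q' ⊆ gr M := Finset.sdiff_subset.trans (hQG.trans hGg)
  have hWg : W ⊆ gr M := Finset.sdiff_subset.trans hGg
  have hind : M.Indep (Q' : Set α) :=
    (indep_insert_of_basis_pair hG hd hk hB hnP hz).subset (by exact_mod_cast (Finset.sdiff_subset))
  have hQ'W : ∀ a ∈ Q', a ∉ W := fun a ha haW => (Finset.mem_sdiff.1 haW).2 (Finset.mem_sdiff.1 ha).1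
  -- the class family: the `W`-parts of the lines through a basis point and a point of `W`
  set 𝓒 : Finset (Finset α) := (Q' ×ˢ W).image (fun p => W ∩ clF M {p.1, p.2}) with h𝓒
  have hCsub : ∀ C ∈ 𝓒, C ⊆ W := by
    intro C hC
    rw [h𝓒, Finset.mem_image] at hC
    obtain ⟨p, -, rfl⟩ := hC
    exact Finset.inter_subset_left
  have hCinter : ∀ C ∈ 𝓒, ∀ C' ∈ 𝓒, C ≠ C' → (C ∩ C').card ≤ 1 := by
    intro C hC C' hC' hne
    rw [h𝓒, Finset.mem_image] at hC hC'
    obtain ⟨p, hp, rfl⟩ := hC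
    obtain ⟨p', hp', rfl⟩ := hC'
    rw [Finset.mem_product] at hp hp'
    by_contra hlt
    push Not at hlt
    obtain ⟨w, hw, w', hw', hww'⟩ := Finset.one_lt_card.1 hlt
    simp only [Finset.mem_inter] at hw hw'
    apply hne
    have hay : p.1 ≠ p.2 := fun h => hQ'W p.1 hp.1 (h ▸ hp.2)
    have hay' : p'.1 ≠ p'.2 := fun h => hQ'W p'.1 hp'.1 (h ▸ hp'.2)
    rw [clF_eq_of_two_mem_inter hs (hQ'g hp.1) (hWg hp.2) (hQ'g hp'.1) (hWg hp'.2) (hWg hw.1.1) (hWg hw'.1.1)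
      hay hay' hww' hw.1.2 hw'.1.2 hw.2.2 hw'.2.2]
  -- the basis-line family
  set 𝓑 : Finset (Finset α) := ((Q' ×ˢ Q').filter (fun p => p.1 ≠ p.2)).image (fun p => W ∩ clF M {p.1, p.2})
    with h𝓑
  have hBsub : ∀ ℓ ∈ 𝓑, ℓ ⊆ W := by
    intro ℓ hℓ
    rw [h𝓑, Finset.mem_image] at hℓ
    obtain ⟨p, -, rfl⟩ := hℓ
    exact Finset.inter_subset_left
  have hBdisj : ∀ ℓ ∈ 𝓑, ∀ ℓ' ∈ 𝓑, ℓ ≠ ℓ' → (ℓ ∩ ℓ').card = 0 := by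
    intro ℓ hℓ ℓ' hℓ' hne
    rw [h𝓑, Finset.mem_image] at hℓ hℓ'
    obtain ⟨p, hp, rfl⟩ := hℓ
    obtain ⟨p', hp', rfl⟩ := hℓ'
    rw [Finset.mem_filter, Finset.mem_product] at hp hp'
    rw [Finset.card_eq_zero, Finset.eq_empty_iff_forall_notMem]
    intro w hw
    simp only [Finset.mem_inter] at hw
    apply hne
    rw [clF_pair_eq_of_mem_of_mem hs hl hQ'g hind hp.1.1 hp.1.2 hp'.1.1 hp'.1.2 hp.2 hp'.2 (hWg hw.1.1)
      (fun h => hQ'W w h hw.1.1) hw.1.2 hw.2.2]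
  -- a nonempty basis line is a class
  have hBC : ∀ ℓ ∈ 𝓑, ℓ.Nonempty → ℓ ∈ 𝓒 := by
    intro ℓ hℓ hne
    rw [h𝓑, Finset.mem_image] at hℓ
    obtain ⟨p, hp, rfl⟩ := hℓ
    rw [Finset.mem_filter, Finset.mem_product] at hp
    obtain ⟨y, hy⟩ := hne
    have hyW : y ∈ W := (Finset.mem_inter.1 hy).1
    have hay : p.1 ≠ y := fun h => hQ'W p.1 hp.1.1 (h ▸ hyW)
    rw [h𝓒, Finset.mem_image]
    refine ⟨(p.1, y), Finset.mem_product.2 ⟨hp.1.1, hyW⟩, ?_⟩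
    exact (inter_clF_pair_eq_of_mem hs hWg (hQ'g hp.1.1) (hQ'g hp.1.2) hp.2 hy hay).symm
  -- the long members
  set 𝓑l := 𝓑.filter (fun ℓ => s - 1 ≤ ℓ.card) with h𝓑l
  set 𝓒l := 𝓒.filter (fun C => s ≤ C.card) with h𝓒l
  obtain ⟨ℓ₁, ℓ₂, hℓ₁, hℓ₂, hcov𝓑⟩ := exists_two_cover_of_pairwise_disjoint W 𝓑l (s - 1)
    (fun ℓ hℓ => hBsub ℓ (Finset.mem_filter.1 hℓ).1)
    (fun ℓ hℓ ℓ' hℓ' hne => hBdisj ℓ (Finset.mem_filter.1 hℓ).1 ℓ' (Finset.mem_filter.1 hℓ').1 hne)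
    (fun ℓ hℓ => (Finset.mem_filter.1 hℓ).2) hmB
  obtain ⟨C₁, C₂, hC₁, hC₂, hcov𝓒⟩ := exists_two_cover_of_pairwise_inter_le_one W 𝓒l s
    (fun C hC => hCsub C (Finset.mem_filter.1 hC).1)
    (fun C hC C' hC' hne => hCinter C (Finset.mem_filter.1 hC).1 C' (Finset.mem_filter.1 hC').1 hne)
    (fun C hC => (Finset.mem_filter.1 hC).2) hmC
  have hℓ₁W : ℓ₁ ⊆ W := by
    rcases hℓ₁ with h | rfl
    · exact hBsub ℓ₁ (Finset.mem_filter.1 h).1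
    · exact Finset.empty_subset _
  have hℓ₂W : ℓ₂ ⊆ W := by
    rcases hℓ₂ with h | rfl
    · exact hBsub ℓ₂ (Finset.mem_filter.1 h).1
    · exact Finset.empty_subset _
  refine ⟨ℓ₁, ℓ₂, C₁, C₂, hℓ₁W, hℓ₂W, ?_, ?_, ?_, ?_, ?_, ?_, ?_, ?_, ?_⟩
  · -- the basis lines are covered
    intro a ha b hb hab
    by_cases hlong : s - 1 ≤ (W ∩ clF M {a, b}).card
    · have hmem : W ∩ clF M {a, b} ∈ 𝓑l := by
        rw [h𝓑l, Finset.mem_filter, h𝓑, Finset.mem_image]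
        exact ⟨⟨(a, b), Finset.mem_filter.2 ⟨Finset.mem_product.2 ⟨ha, hb⟩, hab⟩, rfl⟩, hlong⟩
      rcases hcov𝓑 _ hmem with h | h
      · exact Or.inl (h ▸ Finset.Subset.refl _)
      · exact Or.inr (Or.inl (h ▸ Finset.Subset.refl _))
    · exact Or.inr (Or.inr (by omega))
  · -- the classes are covered
    intro a ha y hy
    by_cases hlong : s ≤ (W ∩ clF M {a, y}).card
    · have hmem : W ∩ clF M {a, y} ∈ 𝓒l := by
        rw [h𝓒l, Finset.mem_filter, h𝓒, Finset.mem_image]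
        exact ⟨⟨(a, y), Finset.mem_product.2 ⟨ha, hy⟩, rfl⟩, hlong⟩
      rcases hcov𝓒 _ hmem with h | h
      · exact Or.inl (h ▸ Finset.Subset.refl _)
      · exact Or.inr (Or.inl (h ▸ Finset.Subset.refl _))
    · exact Or.inr (Or.inr (by omega))
  · -- the origin of `ℓ₁`
    rcases hℓ₁ with h | h
    · right
      rw [h𝓑l, Finset.mem_filter, h𝓑, Finset.mem_image] at h
      obtain ⟨⟨p, hp, hpeq⟩, hcard⟩ := h
      rw [Finset.mem_filter, Finset.mem_product] at hp
      exact ⟨hcard, p.1, hp.1.1, p.2, hp.1.2, hp.2, hpeq.symm⟩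
    · exact Or.inl h
  · rcases hℓ₂ with h | h
    · right
      rw [h𝓑l, Finset.mem_filter, h𝓑, Finset.mem_image] at h
      obtain ⟨⟨p, hp, hpeq⟩, hcard⟩ := h
      rw [Finset.mem_filter, Finset.mem_product] at hp
      exact ⟨hcard, p.1, hp.1.1, p.2, hp.1.2, hp.2, hpeq.symm⟩
    · exact Or.inl h
  · -- `ℓ₁, ℓ₂` are equal or disjoint
    by_cases heq : ℓ₁ = ℓ₂
    · exact Or.inl heq
    · right
      rcases hℓ₁ with h₁ | rfl
      · rcases hℓ₂ with h₂ | rfl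
        · exact hBdisj ℓ₁ (Finset.mem_filter.1 h₁).1 ℓ₂ (Finset.mem_filter.1 h₂).1 heq
        · rw [Finset.inter_empty, Finset.card_empty]
      · rw [Finset.empty_inter, Finset.card_empty]
  · -- the origin of `C₁`
    rcases hC₁ with h | h
    · right
      rw [h𝓒l, Finset.mem_filter, h𝓒, Finset.mem_image] at h
      obtain ⟨⟨p, hp, hpeq⟩, hcard⟩ := h
      rw [Finset.mem_product] at hp
      exact ⟨hcard, p.1, hp.1, p.2, hp.2, hpeq.symm⟩
    · exact Or.inl h
  · rcases hC₂ with h | h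
    · right
      rw [h𝓒l, Finset.mem_filter, h𝓒, Finset.mem_image] at h
      obtain ⟨⟨p, hp, hpeq⟩, hcard⟩ := h
      rw [Finset.mem_product] at hp
      exact ⟨hcard, p.1, hp.1, p.2, hp.2, hpeq.symm⟩
    · exact Or.inl h
  · by_cases heq : C₁ = C₂
    · exact Or.inl heq
    · right
      rcases hC₁ with h₁ | rfl
      · rcases hC₂ with h₂ | rfl
        · exact hCinter C₁ (Finset.mem_filter.1 h₁).1 C₂ (Finset.mem_filter.1 h₂).1 heq
        · rw [Finset.inter_empty, Finset.card_empty]; exact zero_le_one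
      · rw [Finset.empty_inter, Finset.card_empty]; exact zero_le_one
  · -- a long basis line and a long class are equal or share at most one point
    intro ℓ C hℓ hC
    by_cases heq : ℓ = C
    · exact Or.inl heq
    · right
      have hℓ𝓑 : ℓ ∈ 𝓑l ∨ ℓ = ∅ := by
        rcases hℓ with rfl | rfl
        · exact hℓ₁
        · exact hℓ₂
      have hC𝓒 : C ∈ 𝓒l ∨ C = ∅ := by
        rcases hC with rfl | rfl
        · exact hC₁
        · exact hC₂
      rcases hℓ𝓑 with hℓ' | rfl
      · rcases hC𝓒 with hC' | rfl
        · by_cases hne : ℓ.Nonempty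
          · have hℓC : ℓ ∈ 𝓒 := hBC ℓ (Finset.mem_filter.1 hℓ').1 hne
            exact hCinter ℓ hℓC C (Finset.mem_filter.1 hC').1 heq
          · rw [Finset.not_nonempty_iff_eq_empty] at hne
            rw [hne, Finset.empty_inter, Finset.card_empty]; exact zero_le_one
        · rw [Finset.inter_empty, Finset.card_empty]; exact zero_le_one
      · rw [Finset.empty_inter, Finset.card_empty]; exact zero_le_one

end PercRepro.Shadow
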